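import Summits.QuantumFields.YangMills.Theorems.AllWindowsColdBoxExpFourCubicTaylor
import Literature.MathematicalPhysics.QuantumLattice.YangMillsClassical
import HarnessLib

/-!
# The cubic Taylor polynomial of the cost of a PERTURBED unitary holonomy `(e^{A₁}V₁)(e^{A₂}V₂)(e^{A₃}V₃)⁻¹(e^{A₄}V₄)⁻¹` at a FLAT background
# (layer (B3-phase), per-term step, of the DIRECT Laplace road to ⟨stmt-QuantumFields-24204⟩ `VirialFluxGap.SharpTwistedLaplace`)

Helper module (free-hands work of width seat ym-line-sfw-p2-w3 g56, cell ym-idea-1; `--supports 24204`).  In the product exponential chart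
`U_e = e^{A_e}·U⁰_e` (LEFT multiplication, skew-Hermitian `A_e`, Frobenius norms) at a zero of the twisted ring deficit every term of the
deficit — temporal bond, twisted seam bond, spatial plaquette — is the unitary cost `N − Re tr` of a word `(e^{A₁}V₁)(e^{A₂}V₂)(e^{A₃}V₃)⁻¹(e^{A₄}V₄)⁻¹`
whose BACKGROUND holonomy `V₁V₂V₃⁻¹V₄⁻¹` is `1` (flat slice, twist-eaten seam).  Transporting the perturbations to the base point,
`X₁ = A₁`, `X₂ = V₁A₂V₁⁻¹`, `X₃ = (V₁V₂V₃⁻¹)A₃(V₁V₂V₃⁻¹)⁻¹`, `X₄ = A₄` (skew-Hermitian, same Frobenius norms), the word IS the free holonomy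
`e^{X₁}e^{X₂}(e^{X₃})⁻¹(e^{X₄})⁻¹` (`perturbed_holonomy_eq`), so the tree's ✓`ColdBoxAllGroups.abs_cost_exp_holonomy_sub_cubic_le` (w5 g18) gives

  ★ `abs_cost_perturbed_holonomy_sub_cubic_le`:  `|(N − Re tr word) − ½‖S‖² + ½Re tr(S·K±)| ≤ 560·m⁴`  (`‖Aᵢ‖ ≤ m ≤ 1/4`),

`S = X₁ + X₂ − X₃ − X₄` the transported linear circulation, `K±` the signed commutator sum of the `Xᵢ` — i.e. an explicit QUADRATIC form plus
an explicit ODD CUBIC form plus `O(m⁴)` with an ABSOLUTE constant: the per-term input of the window data (`A₃`, `A₄`) of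
✓`QuantitativeLaplace.laplaceMethod_quantitative_of_eqOn` along any slice of the product chart.  Also: `abs_cost_temporal_sub_cubic_le` (two
factors: `(e^{A}U)(e^{A'}U)⁻¹`, circulation `A − A'`), the Frobenius bookkeeping `frobenius_norm_unitary_conj`, `conjTranspose_unitary_conj_skew`,
`exp_unitary_conj`, `conjTranspose_mem_unitaryGroup`, and the size bounds `norm_circulation_le`, `abs_re_trace_circulation_mul_commSum_le` (`|½Re tr(S·K±)| ≤ 48m³`, `½‖S‖² ≤ 8m²`).

Everything here is PROVED; no definitions, no named facts (namespace `Summit.QuantumFields.YangMills.Theorems.VirialFluxGap.ChartPhase`).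
HONEST FRAMING: matrix calculus; ⟨24204⟩, ⟨24319⟩ and every rung stay OPEN; the Yang–Mills mass gap (Clay) is NOT touched; no summit is proved
by a line.

## References
* K. W. Breitung, *Asymptotic Approximations for Probability Integrals*, LNM 1592 (1994), Lemma 7 p. 12 (Taylor data of Laplace integrands). [Breitung1994]
* M. Lüscher, Nucl. Phys. B219 (1983), §2 (expansion around twist-eating flat connections). [Luscher1983]
-/

set_option autoImplicit false

noncomputable section

open scoped Matrix Matrix.Norms.Frobenius
open NormedSpace

namespace Summit.QuantumFields.YangMills.Theorems.VirialFluxGap.ChartPhase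

open Summit.QuantumFields.YangMills.Theorems.ColdBoxAllGroups

variable {N : ℕ}

/-! ## §1 Unitary transport of skew-Hermitian perturbations -/

/- (`V Vᴴ = 1`, `Vᴴ V = 1` for unitary `V` are used inline below: `Matrix.mem_unitaryGroup_iff(')` read through `star = ᴴ`; they are
landed elsewhere as `UnitScaleGibbsActionDerivativeGaussianDomination.(conjTranspose_)mul_(conjTranspose_)of_mem_unitary`, whose module is
not imported here to keep the import cone small.) -/

/-- The conjugate transpose of a unitary matrix is unitary. [folklore] -/
theorem conjTranspose_mem_unitaryGroup {V : Matrix (Fin N) (Fin N) ℂ} (hV : V ∈ Matrix.unitaryGroup (Fin N) ℂ) :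
    Vᴴ ∈ Matrix.unitaryGroup (Fin N) ℂ := by
  rw [← Matrix.star_eq_conjTranspose]; exact Unitary.star_mem hV

/-- **Frobenius norms are transport invariant**: `‖V A Vᴴ‖ = ‖A‖` for unitary `V`. [cite: HornJohnson2013, Thm 2.2.2] -/
theorem frobenius_norm_unitary_conj {V : Matrix (Fin N) (Fin N) ℂ} (hV : V ∈ Matrix.unitaryGroup (Fin N) ℂ) (A : Matrix (Fin N) (Fin N) ℂ) :
    ‖V * A * Vᴴ‖ = ‖A‖ := by
  have hV' : Vᴴ ∈ Matrix.unitaryGroup (Fin N) ℂ := conjTranspose_mem_unitaryGroup hV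
  have h1 := Matrix.frobenius_norm_unitaryGroup_mul (⟨V, hV⟩ : Matrix.unitaryGroup (Fin N) ℂ) (A * Vᴴ)
  have h2 := Matrix.frobenius_norm_mul_unitaryGroup A (⟨Vᴴ, hV'⟩ : Matrix.unitaryGroup (Fin N) ℂ)
  simp only at h1 h2
  rw [Matrix.mul_assoc, h1, h2]

/-- Transport preserves skew-Hermitianness: `(V A Vᴴ)ᴴ = −(V A Vᴴ)` if `Aᴴ = −A`. [folklore] -/
theorem conjTranspose_unitary_conj_skew (V : Matrix (Fin N) (Fin N) ℂ) {A : Matrix (Fin N) (Fin N) ℂ} (hA : Aᴴ = -A) :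
    (V * A * Vᴴ)ᴴ = -(V * A * Vᴴ) := by
  rw [Matrix.conjTranspose_mul, Matrix.conjTranspose_mul, Matrix.conjTranspose_conjTranspose, hA]
  simp only [Matrix.neg_mul, Matrix.mul_neg, Matrix.mul_assoc]

/-- **The exponential commutes with transport**: `e^{V A Vᴴ} = V e^{A} Vᴴ` for unitary `V` (Mathlib `Matrix.exp_units_conj`). [folklore] -/
theorem exp_unitary_conj {V : Matrix (Fin N) (Fin N) ℂ} (hV : V ∈ Matrix.unitaryGroup (Fin N) ℂ) (A : Matrix (Fin N) (Fin N) ℂ) :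
    exp (V * A * Vᴴ) = V * exp A * Vᴴ := by
  have hVV : V * Vᴴ = 1 := by simpa only [Matrix.star_eq_conjTranspose] using Matrix.mem_unitaryGroup_iff.mp hV
  have hVV' : Vᴴ * V = 1 := by simpa only [Matrix.star_eq_conjTranspose] using Matrix.mem_unitaryGroup_iff'.mp hV
  let u : (Matrix (Fin N) (Fin N) ℂ)ˣ := ⟨V, Vᴴ, hVV, hVV'⟩
  have hu : (u : Matrix (Fin N) (Fin N) ℂ) = V := rfl
  have hui : ((u⁻¹ : (Matrix (Fin N) (Fin N) ℂ)ˣ) : Matrix (Fin N) (Fin N) ℂ) = Vᴴ := rfl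
  have h := Matrix.exp_units_conj u A
  rw [hu, hui] at h
  exact h

/-- `(e^{A} V)ᴴ = Vᴴ e^{−A}` for skew-Hermitian `A`. [folklore] -/
theorem conjTranspose_exp_mul {A : Matrix (Fin N) (Fin N) ℂ} (hA : Aᴴ = -A) (V : Matrix (Fin N) (Fin N) ℂ) :
    (exp A * V)ᴴ = Vᴴ * exp (-A) := by
  rw [Matrix.conjTranspose_mul, ← Matrix.exp_conjTranspose, hA]

/-! ## §2 ★ The perturbed holonomy at a flat background is a free holonomy of transported perturbations -/

/-- ★ **Transport identity.**  For unitary `V₁,…,V₄` with flat background holonomy `V₁V₂V₃ᴴV₄ᴴ = 1` and skew-Hermitian `A₃`: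
`(e^{A₁}V₁)(e^{A₂}V₂)(e^{A₃}V₃)ᴴ(e^{A₄}V₄)ᴴ = e^{A₁}·e^{V₁A₂V₁ᴴ}·e^{−WA₃Wᴴ}·e^{−A₄}`, `W = V₁V₂V₃ᴴ`. [cite: Luscher1983, §2] -/
theorem perturbed_holonomy_eq {V₁ V₂ V₃ V₄ A₁ A₂ A₃ A₄ : Matrix (Fin N) (Fin N) ℂ}
    (hV₁ : V₁ ∈ Matrix.unitaryGroup (Fin N) ℂ) (hV₂ : V₂ ∈ Matrix.unitaryGroup (Fin N) ℂ) (hV₃ : V₃ ∈ Matrix.unitaryGroup (Fin N) ℂ)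
    (hhol : V₁ * V₂ * V₃ᴴ * V₄ᴴ = 1) (hA₃ : A₃ᴴ = -A₃) (hA₄ : A₄ᴴ = -A₄) :
    exp A₁ * V₁ * (exp A₂ * V₂) * (exp A₃ * V₃)ᴴ * (exp A₄ * V₄)ᴴ =
      exp A₁ * exp (V₁ * A₂ * V₁ᴴ) * exp (-((V₁ * V₂ * V₃ᴴ) * A₃ * (V₁ * V₂ * V₃ᴴ)ᴴ)) * exp (-A₄) := by
  have hW : V₁ * V₂ * V₃ᴴ ∈ Matrix.unitaryGroup (Fin N) ℂ := mul_mem (mul_mem hV₁ hV₂) (conjTranspose_mem_unitaryGroup hV₃)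
  set W : Matrix (Fin N) (Fin N) ℂ := V₁ * V₂ * V₃ᴴ with hWdef
  have hV₁' : V₁ᴴ * V₁ = 1 := by simpa only [Matrix.star_eq_conjTranspose] using Matrix.mem_unitaryGroup_iff'.mp hV₁
  have hW' : Wᴴ * W = 1 := by simpa only [Matrix.star_eq_conjTranspose] using Matrix.mem_unitaryGroup_iff'.mp hW
  -- transports
  have h2 : V₁ * exp A₂ = exp (V₁ * A₂ * V₁ᴴ) * V₁ := by
    rw [exp_unitary_conj hV₁]
    calc V₁ * exp A₂ = V₁ * exp A₂ * 1 := by rw [Matrix.mul_one]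
      _ = V₁ * exp A₂ * (V₁ᴴ * V₁) := by rw [hV₁']
      _ = V₁ * exp A₂ * V₁ᴴ * V₁ := by simp only [Matrix.mul_assoc]
  have h3 : W * exp (-A₃) = exp (-(W * A₃ * Wᴴ)) * W := by
    have e : -(W * A₃ * Wᴴ) = W * (-A₃) * Wᴴ := by rw [Matrix.mul_neg, Matrix.neg_mul]
    rw [e, exp_unitary_conj hW]
    calc W * exp (-A₃) = W * exp (-A₃) * 1 := by rw [Matrix.mul_one]
      _ = W * exp (-A₃) * (Wᴴ * W) := by rw [hW']
      _ = W * exp (-A₃) * Wᴴ * W := by simp only [Matrix.mul_assoc]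
  have h4 : W * V₄ᴴ = 1 := by rw [hWdef]; exact hhol
  rw [conjTranspose_exp_mul hA₃, conjTranspose_exp_mul hA₄]
  calc exp A₁ * V₁ * (exp A₂ * V₂) * (V₃ᴴ * exp (-A₃)) * (V₄ᴴ * exp (-A₄))
      = exp A₁ * (V₁ * exp A₂) * V₂ * V₃ᴴ * exp (-A₃) * V₄ᴴ * exp (-A₄) := by simp only [Matrix.mul_assoc]
    _ = exp A₁ * exp (V₁ * A₂ * V₁ᴴ) * (W * exp (-A₃)) * V₄ᴴ * exp (-A₄) := by rw [h2, hWdef]; simp only [Matrix.mul_assoc]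
    _ = exp A₁ * exp (V₁ * A₂ * V₁ᴴ) * exp (-(W * A₃ * Wᴴ)) * (W * V₄ᴴ) * exp (-A₄) := by rw [h3]; simp only [Matrix.mul_assoc]
    _ = exp A₁ * exp (V₁ * A₂ * V₁ᴴ) * exp (-(W * A₃ * Wᴴ)) * exp (-A₄) := by rw [h4, Matrix.mul_one]

/-! ## §3 ★ The cubic Taylor polynomial of the perturbed cost -/

/-- ★ **Cubic Taylor polynomial of the cost of a perturbed holonomy at a flat background.**  For unitary `V₁,…,V₄` with `V₁V₂V₃ᴴV₄ᴴ = 1`,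
skew-Hermitian `A₁,…,A₄` with Frobenius norms `≤ m ≤ 1/4`, and the TRANSPORTED perturbations `X₂ = V₁A₂V₁ᴴ`, `X₃ = WA₃Wᴴ` (`W = V₁V₂V₃ᴴ`):
`|(N − Re tr((e^{A₁}V₁)(e^{A₂}V₂)(e^{A₃}V₃)ᴴ(e^{A₄}V₄)ᴴ)) − ½‖S‖² + ½Re tr(S·K±)| ≤ 560·m⁴` with `S = A₁ + X₂ − X₃ − A₄` and `K±` the signed
commutator sum of `(A₁, X₂, X₃, A₄)` (✓`abs_cost_exp_holonomy_sub_cubic_le`). [cite: Breitung1994, Lemma 7 p. 12] [cite: Luscher1983, §2] -/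
theorem abs_cost_perturbed_holonomy_sub_cubic_le {V₁ V₂ V₃ V₄ A₁ A₂ A₃ A₄ X₂ X₃ : Matrix (Fin N) (Fin N) ℂ}
    (hV₁ : V₁ ∈ Matrix.unitaryGroup (Fin N) ℂ) (hV₂ : V₂ ∈ Matrix.unitaryGroup (Fin N) ℂ) (hV₃ : V₃ ∈ Matrix.unitaryGroup (Fin N) ℂ)
    (hhol : V₁ * V₂ * V₃ᴴ * V₄ᴴ = 1)
    (hA₁ : A₁ᴴ = -A₁) (hA₂ : A₂ᴴ = -A₂) (hA₃ : A₃ᴴ = -A₃) (hA₄ : A₄ᴴ = -A₄)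
    {m : ℝ} (hm : m ≤ 1 / 4) (h₁ : ‖A₁‖ ≤ m) (h₂ : ‖A₂‖ ≤ m) (h₃ : ‖A₃‖ ≤ m) (h₄ : ‖A₄‖ ≤ m)
    (hX₂ : X₂ = V₁ * A₂ * V₁ᴴ) (hX₃ : X₃ = (V₁ * V₂ * V₃ᴴ) * A₃ * (V₁ * V₂ * V₃ᴴ)ᴴ) :
    |((N : ℝ) - (exp A₁ * V₁ * (exp A₂ * V₂) * (exp A₃ * V₃)ᴴ * (exp A₄ * V₄)ᴴ).trace.re) - ‖A₁ + X₂ - X₃ - A₄‖ ^ 2 / 2 +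
        ((A₁ + X₂ - X₃ - A₄) * ((A₁ * X₂ - X₂ * A₁) - (A₁ * X₃ - X₃ * A₁) - (A₁ * A₄ - A₄ * A₁) - (X₂ * X₃ - X₃ * X₂) -
          (X₂ * A₄ - A₄ * X₂) + (X₃ * A₄ - A₄ * X₃))).trace.re / 2| ≤ 560 * m ^ 4 := by
  have hW : V₁ * V₂ * V₃ᴴ ∈ Matrix.unitaryGroup (Fin N) ℂ := mul_mem (mul_mem hV₁ hV₂) (conjTranspose_mem_unitaryGroup hV₃)
  have hX₂s : X₂ᴴ = -X₂ := by rw [hX₂]; exact conjTranspose_unitary_conj_skew V₁ hA₂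
  have hX₃s : X₃ᴴ = -X₃ := by rw [hX₃]; exact conjTranspose_unitary_conj_skew _ hA₃
  have hX₂n : ‖X₂‖ ≤ m := by rw [hX₂, frobenius_norm_unitary_conj hV₁]; exact h₂
  have hX₃n : ‖X₃‖ ≤ m := by rw [hX₃, frobenius_norm_unitary_conj hW]; exact h₃
  have key := abs_cost_exp_holonomy_sub_cubic_le hA₁ hX₂s hX₃s hA₄ hm h₁ hX₂n hX₃n h₄
  rw [inv_exp_eq_exp_neg, inv_exp_eq_exp_neg] at key
  rw [perturbed_holonomy_eq hV₁ hV₂ hV₃ hhol hA₃ hA₄, ← hX₂, ← hX₃]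
  exact key

/-- **Temporal bond**: for unitary `U` and skew-Hermitian `A, A'` with norms `≤ m ≤ 1/4`,
`|(N − Re tr((e^{A}U)(e^{A'}U)ᴴ)) − ½‖A − A'‖² − ½Re tr((A − A')(AA' − A'A))| ≤ 560·m⁴` (the cubic term in fact vanishes by cyclicity;
it is kept in the common format). [cite: Luscher1983, §2] -/
theorem abs_cost_temporal_sub_cubic_le {U A A' : Matrix (Fin N) (Fin N) ℂ} (hU : U ∈ Matrix.unitaryGroup (Fin N) ℂ)
    (hA : Aᴴ = -A) (hA' : A'ᴴ = -A') {m : ℝ} (hm : m ≤ 1 / 4) (h : ‖A‖ ≤ m) (h' : ‖A'‖ ≤ m) :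
    |((N : ℝ) - (exp A * U * (exp A' * U)ᴴ).trace.re) - ‖A - A'‖ ^ 2 / 2 -
        ((A - A') * (A * A' - A' * A)).trace.re / 2| ≤ 560 * m ^ 4 := by
  have hm0 : 0 ≤ m := (norm_nonneg _).trans h
  have h1 : (1 : Matrix (Fin N) (Fin N) ℂ) ∈ Matrix.unitaryGroup (Fin N) ℂ := one_mem _
  have h0s : (0 : Matrix (Fin N) (Fin N) ℂ)ᴴ = -0 := by rw [Matrix.conjTranspose_zero, neg_zero]
  have h0n : ‖(0 : Matrix (Fin N) (Fin N) ℂ)‖ ≤ m := by rw [norm_zero]; exact hm0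
  have hUU : U * Uᴴ = 1 := by simpa only [Matrix.star_eq_conjTranspose] using Matrix.mem_unitaryGroup_iff.mp hU
  have hhol : U * 1 * (1 : Matrix (Fin N) (Fin N) ℂ)ᴴ * Uᴴ = 1 := by
    rw [Matrix.mul_one, Matrix.conjTranspose_one, Matrix.mul_one, hUU]
  have key := abs_cost_perturbed_holonomy_sub_cubic_le (A₁ := A) (A₂ := 0) (A₃ := 0) (A₄ := A') (X₂ := 0) (X₃ := 0)
    hU h1 h1 hhol hA h0s h0s hA' hm h h0n h0n h'
    (by rw [Matrix.mul_zero, Matrix.zero_mul]) (by rw [Matrix.mul_zero, Matrix.zero_mul])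
  have e1 : exp A * U * (exp (0 : Matrix (Fin N) (Fin N) ℂ) * 1) * (exp (0 : Matrix (Fin N) (Fin N) ℂ) * 1)ᴴ * (exp A' * U)ᴴ =
      exp A * U * (exp A' * U)ᴴ := by
    rw [exp_zero, Matrix.mul_one, Matrix.conjTranspose_one, Matrix.mul_one, Matrix.mul_one]
  rw [e1] at key
  have e2 : A + 0 - 0 - A' = A - A' := by abel
  have e3 : (A * 0 - 0 * A) - (A * 0 - 0 * A) - (A * A' - A' * A) - (0 * 0 - 0 * 0) - (0 * A' - A' * 0) + (0 * A' - A' * 0) =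
      -(A * A' - A' * A) := by simp only [Matrix.mul_zero, Matrix.zero_mul, sub_zero, zero_sub, add_zero, sub_self]
  rw [e2, e3, Matrix.mul_neg, Matrix.trace_neg, Complex.neg_re, neg_div] at key
  simpa [sub_eq_add_neg] using key

/-! ## §4 Sizes of the quadratic and cubic forms -/

/-- The transported circulation has norm at most `4m`. [folklore] -/
theorem norm_circulation_le {X₁ X₂ X₃ X₄ : Matrix (Fin N) (Fin N) ℂ} {m : ℝ} (h₁ : ‖X₁‖ ≤ m) (h₂ : ‖X₂‖ ≤ m) (h₃ : ‖X₃‖ ≤ m)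
    (h₄ : ‖X₄‖ ≤ m) : ‖X₁ + X₂ - X₃ - X₄‖ ≤ 4 * m := by
  calc ‖X₁ + X₂ - X₃ - X₄‖ ≤ ‖X₁ + X₂ - X₃‖ + ‖X₄‖ := norm_sub_le _ _
    _ ≤ ‖X₁ + X₂‖ + ‖X₃‖ + ‖X₄‖ := by linarith [norm_sub_le (X₁ + X₂) X₃]
    _ ≤ ‖X₁‖ + ‖X₂‖ + ‖X₃‖ + ‖X₄‖ := by linarith [norm_add_le X₁ X₂]
    _ ≤ 4 * m := by linarith

/-- The quadratic form of one term is at most `8m²`: `½‖S‖² ≤ 8m²`. [folklore] -/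
theorem half_norm_circulation_sq_le {X₁ X₂ X₃ X₄ : Matrix (Fin N) (Fin N) ℂ} {m : ℝ} (h₁ : ‖X₁‖ ≤ m) (h₂ : ‖X₂‖ ≤ m) (h₃ : ‖X₃‖ ≤ m)
    (h₄ : ‖X₄‖ ≤ m) : ‖X₁ + X₂ - X₃ - X₄‖ ^ 2 / 2 ≤ 8 * m ^ 2 := by
  have hm0 : 0 ≤ m := (norm_nonneg _).trans h₁
  have h := norm_circulation_le h₁ h₂ h₃ h₄
  have hsq : ‖X₁ + X₂ - X₃ - X₄‖ ^ 2 ≤ (4 * m) ^ 2 := pow_le_pow_left₀ (norm_nonneg _) h 2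
  nlinarith

/-- The signed commutator sum has norm at most `12m²`. [folklore] -/
theorem norm_commSum_le {X₁ X₂ X₃ X₄ : Matrix (Fin N) (Fin N) ℂ} {m : ℝ} (h₁ : ‖X₁‖ ≤ m) (h₂ : ‖X₂‖ ≤ m) (h₃ : ‖X₃‖ ≤ m)
    (h₄ : ‖X₄‖ ≤ m) :
    ‖(X₁ * X₂ - X₂ * X₁) - (X₁ * X₃ - X₃ * X₁) - (X₁ * X₄ - X₄ * X₁) - (X₂ * X₃ - X₃ * X₂) - (X₂ * X₄ - X₄ * X₂) + (X₃ * X₄ - X₄ * X₃)‖ ≤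
      12 * m ^ 2 := by
  have hm0 : 0 ≤ m := (norm_nonneg _).trans h₁
  have c12 := norm_commutator_le h₁ h₂
  have c13 := norm_commutator_le h₁ h₃
  have c14 := norm_commutator_le h₁ h₄
  have c23 := norm_commutator_le h₂ h₃
  have c24 := norm_commutator_le h₂ h₄
  have c34 := norm_commutator_le h₃ h₄
  calc _ ≤ ‖(X₁ * X₂ - X₂ * X₁) - (X₁ * X₃ - X₃ * X₁) - (X₁ * X₄ - X₄ * X₁) - (X₂ * X₃ - X₃ * X₂) - (X₂ * X₄ - X₄ * X₂)‖ + ‖X₃ * X₄ - X₄ * X₃‖ :=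
        norm_add_le _ _
    _ ≤ ‖(X₁ * X₂ - X₂ * X₁) - (X₁ * X₃ - X₃ * X₁) - (X₁ * X₄ - X₄ * X₁) - (X₂ * X₃ - X₃ * X₂)‖ + ‖X₂ * X₄ - X₄ * X₂‖ + ‖X₃ * X₄ - X₄ * X₃‖ := by
        linarith [norm_sub_le ((X₁ * X₂ - X₂ * X₁) - (X₁ * X₃ - X₃ * X₁) - (X₁ * X₄ - X₄ * X₁) - (X₂ * X₃ - X₃ * X₂)) (X₂ * X₄ - X₄ * X₂)]
    _ ≤ ‖(X₁ * X₂ - X₂ * X₁) - (X₁ * X₃ - X₃ * X₁) - (X₁ * X₄ - X₄ * X₁)‖ + ‖X₂ * X₃ - X₃ * X₂‖ + ‖X₂ * X₄ - X₄ * X₂‖ + ‖X₃ * X₄ - X₄ * X₃‖ := by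
        linarith [norm_sub_le ((X₁ * X₂ - X₂ * X₁) - (X₁ * X₃ - X₃ * X₁) - (X₁ * X₄ - X₄ * X₁)) (X₂ * X₃ - X₃ * X₂)]
    _ ≤ ‖(X₁ * X₂ - X₂ * X₁) - (X₁ * X₃ - X₃ * X₁)‖ + ‖X₁ * X₄ - X₄ * X₁‖ + ‖X₂ * X₃ - X₃ * X₂‖ + ‖X₂ * X₄ - X₄ * X₂‖ + ‖X₃ * X₄ - X₄ * X₃‖ := by
        linarith [norm_sub_le ((X₁ * X₂ - X₂ * X₁) - (X₁ * X₃ - X₃ * X₁)) (X₁ * X₄ - X₄ * X₁)]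
    _ ≤ ‖X₁ * X₂ - X₂ * X₁‖ + ‖X₁ * X₃ - X₃ * X₁‖ + ‖X₁ * X₄ - X₄ * X₁‖ + ‖X₂ * X₃ - X₃ * X₂‖ + ‖X₂ * X₄ - X₄ * X₂‖ + ‖X₃ * X₄ - X₄ * X₃‖ := by
        linarith [norm_sub_le (X₁ * X₂ - X₂ * X₁) (X₁ * X₃ - X₃ * X₁)]
    _ ≤ 12 * m ^ 2 := by linarith

/-- The cubic form of one term is at most `24m³` in absolute value: `|½Re tr(S·K±)| ≤ 24m³`. [folklore] -/
theorem abs_cubicForm_le {X₁ X₂ X₃ X₄ : Matrix (Fin N) (Fin N) ℂ} {m : ℝ} (h₁ : ‖X₁‖ ≤ m) (h₂ : ‖X₂‖ ≤ m) (h₃ : ‖X₃‖ ≤ m)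
    (h₄ : ‖X₄‖ ≤ m) :
    |((X₁ + X₂ - X₃ - X₄) * ((X₁ * X₂ - X₂ * X₁) - (X₁ * X₃ - X₃ * X₁) - (X₁ * X₄ - X₄ * X₁) - (X₂ * X₃ - X₃ * X₂) -
          (X₂ * X₄ - X₄ * X₂) + (X₃ * X₄ - X₄ * X₃))).trace.re / 2| ≤ 24 * m ^ 3 := by
  have hm0 : 0 ≤ m := (norm_nonneg _).trans h₁
  have hS := norm_circulation_le h₁ h₂ h₃ h₄
  have hK := norm_commSum_le h₁ h₂ h₃ h₄
  have h := abs_re_trace_mul_le (X₁ + X₂ - X₃ - X₄) ((X₁ * X₂ - X₂ * X₁) - (X₁ * X₃ - X₃ * X₁) - (X₁ * X₄ - X₄ * X₁) -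
    (X₂ * X₃ - X₃ * X₂) - (X₂ * X₄ - X₄ * X₂) + (X₃ * X₄ - X₄ * X₃))
  rw [abs_div, abs_two]
  have : |((X₁ + X₂ - X₃ - X₄) * ((X₁ * X₂ - X₂ * X₁) - (X₁ * X₃ - X₃ * X₁) - (X₁ * X₄ - X₄ * X₁) - (X₂ * X₃ - X₃ * X₂) -
          (X₂ * X₄ - X₄ * X₂) + (X₃ * X₄ - X₄ * X₃))).trace.re| ≤ (4 * m) * (12 * m ^ 2) :=
    h.trans (mul_le_mul hS hK (norm_nonneg _) (by positivity))
  rw [div_le_iff₀ (by norm_num : (0:ℝ) < 2)]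
  nlinarith

end Summit.QuantumFields.YangMills.Theorems.VirialFluxGap.ChartPhase

end
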